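import Mathlib
import HarnessLib
import HarnessLib.Audit
import Summits.AtomisticToContinuum.Statement
import Literature.MathematicalPhysics.QuantumManyBody.PeriodicBoseGas

/-!
Route: EqualScatteringTransfer

CLOSED (retired) 2026-08-15T13:42:12Z by operator:999:1257524 — reason: not-a-thesis: assembly does not conclude the sub-problem Statement — note: D-0027 §2.1 audit (human 2026-08-15: routes that do not decide the summit are removed): the assembly concludes `Literature.MathematicalPhysics.QuantumManyBody.BoseGas.BoseEinsteinCondensation`, not the sub-problem statement; a NEW conforming route may be opened from the same idea (generated `closes . The file is kept as the record of this route; refuted decls are indexed as negative knowledge (`ledger negatives`).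

# Route EqualScatteringTransfer — equal scattering length, equal condensation — transfer ODLRO by a
pair-neutral dressing, then prove BEC for one bounded representative per a

X = X_T ∧ X_R ("it suffices to show"). X_T (SCATTERING-LENGTH TRANSFER): for admissible (repulsive,
measurable,
finite-range) radial profiles v, w with v BOUNDED and scatteringLength v = scatteringLength w,
ground-state BEC at all small
densities for v implies ground-state BEC at all small densities for w (w arbitrary admissible: hard
cores allowed).
X_R (REPRESENTATIVE BEC): for every real a ≥ 0 SOME bounded admissible v with scatteringLength v = a
has ground-state BEC at
all small densities. Since finite range forces a(w) < ∞ (support ScatteringLengthFinite), X_T ∧ X_R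
gives the conjunct for
every w: the ∀v of BoseEinsteinCondensation collapses to one representative per value of a, chosen
as soft as one likes.
Card realised: equal-scattering-length-transfer (spine). Its quantitative heart is filed as the
rank-2 crux
CondensateComparison (finite volume, uniform in N); X_T is rank 3, X_R rank 4.
Lean: `(∀ v w : ℝ → ENNReal,
Literature.MathematicalPhysics.QuantumManyBody.BoseGas.IsRepulsiveFiniteRange v →
Literature.MathematicalPhysics.QuantumManyBody.BoseGas.IsRepulsiveFiniteRange w → (∃ M : NNReal, ∀
r, v r ≤ M) → Literature.MathematicalPhysics.QuantumManyBody.BoseGas.scatteringLength v =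
Literature.MathematicalPhysics.QuantumManyBody.BoseGas.scatteringLength w → (∃ ρ₀ : ℝ, 0 < ρ₀ ∧ ∀ ρ
: ℝ, 0 < ρ → ρ < ρ₀ → Literature.MathematicalPhysics.QuantumManyBody.BoseGas.HasGroundStateBEC v ρ)
→ ∃ ρ₀ : ℝ, 0 < ρ₀ ∧ ∀ ρ : ℝ, 0 < ρ → ρ < ρ₀ →
Literature.MathematicalPhysics.QuantumManyBody.BoseGas.HasGroundStateBEC w ρ) ∧ (∀ a : ℝ, 0 ≤ a → ∃
v : ℝ → ENNReal, Literature.MathematicalPhysics.QuantumManyBody.BoseGas.IsRepulsiveFiniteRange v ∧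
(∃ M : NNReal, ∀ r, v r ≤ M) ∧
Literature.MathematicalPhysics.QuantumManyBody.BoseGas.scatteringLength v = ENNReal.ofReal a ∧ ∃ ρ₀
: ℝ, 0 < ρ₀ ∧ ∀ ρ : ℝ, 0 < ρ → ρ < ρ₀ →
Literature.MathematicalPhysics.QuantumManyBody.BoseGas.HasGroundStateBEC v ρ)`

## Assembly
Pure logic (sorry-free in Sketch.lean, five lines): given admissible w, ScatteringLengthFinite gives
a := scatteringLength w ≠ ⊤;
RepresentativeBEC at a.toReal ≥ 0 gives a bounded admissible v with scatteringLength v = ofReal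
a.toReal = a
(ENNReal.ofReal_toReal) and small-density BEC for v; ScatteringLengthTransfer v w closes the
conjunct for w.

Rationale: WHY THIS LINE. Mechanism (card equal-scattering-length-transfer): at equal a the zero-energy pair
profiles f_v, f_w (Literature: scatteringProfile)
coincide beyond the ranges, so the collision dressing D = Π_{i<j} f_w/f_v(x_i − x_j) equals 1 unless
a pair collides, and the
Jastrow–Dyson computation (doi:10.1103/PhysRev.98.1479, Dyson1957, LSSY2005 proof of Thm 2.2)
applied to the QUOTIENT gives
H_w(DΨ_v) = (E₀^v + Q)DΨ_v with the pair-level part of Q vanishing identically: Q is a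
collision-supported (≥3)-body term whose
hydrodynamic vertex has no 1/k enhancement, so the corrector g = Ψ_w/(DΨ_v) — the principal
eigenfunction of the ground-state
transformed generator −L + Q, in Kipnis–Varadhan corrector language (doi:10.1007/BF01210789) —
should have one-particle
oscillation O(1) uniformly in N, and through the affinity representation γ(x,y) =
√(ρ₁(x)ρ₁(y))·BC(P_x,P_y) of a positive
ground state this transfers λ_max(γ) ≥ cN from v to w with a power loss (CondensateComparison).
Imported areas: Doob/ground-state
transformation and corrector theory for reversible diffusions (probability), Hellinger-affinity
change-of-measure inequalities
(measure theory); physics calibration: v-dependence of n₀ enters only at relative order ρa³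
(doi:10.1103/physreva.63.063609) and
diffusion Monte Carlo sees hard- and soft-sphere gases of equal a with equal energy AND condensate
fraction at low na³
(doi:10.1103/physreva.60.5129). What it does that prior routes do not: it never bounds an energy to
condensation precision
(BECPinning, BECInfraredBound, BECPeriodicReduction live in the energy/gap currency), it turns
LSSY's posed question (LSSY2005 Ch. 2
after (2.8), PDF p. 16: equal-a hard vs soft regimes, "whether they behave differently with respect
to … Bose–Einstein
condensation is not known") into a theorem-shape, and it hands every method route (BECRenormGroup,
cluster / RP / Lee–Yang cards)
the softest admissible representative (Born parameter λR² → 0 at fixed a ≈ λR³/6) instead of ∀v; the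
negatives index is empty.

RANKED CRUXES. #2 CondensateComparison (crux) — for admissible v (bounded) and w (arbitrary, hard
cores allowed) with scatteringLength v = scatteringLength w there are ρ₁, κ, C > 0 such that for ALL
N ≥ 1 and L > 0 with N/L³ < ρ₁: condensateNumber w N L ≥ κ · N · (condensateNumber v N L / N)^C —
the condensate numbers (λ_max of the one-particle density matrix of the Dirichlet ground state) of
two equal-a gases are comparable by a power law uniformly in the volume (card T1 + T2 + affinity
identity, in typable dress). [difficulty: XL] (why it might fail: log g, g = Ψ_w/(DΨ_v), is an
extensive Feynman–Kac functional; N-uniform one-particle oscillation needs a cumulant expansion in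
ρR³ resting on local mixing of the Ψ_v² diffusion — possibly as deep as BEC(v); hard-core w adds
contact singularities of ∇log f_w; κ, C may drift with N.) [doi:10.1103/PhysRev.98.1479, Dyson1957,
LSSY2005, doi:10.1007/BF01210789, doi:10.1103/physreva.63.063609, doi:10.1103/physreva.60.5129,
Basti2022, BoccatoEtAl2019]
#3 ScatteringLengthTransfer (crux) — X_T — for admissible v, w with v bounded and scatteringLength v
= scatteringLength w: (∃ ρ₀ > 0, ∀ ρ ∈ (0,ρ₀), HasGroundStateBEC v ρ) → (∃ ρ₀' > 0, ∀ ρ ∈ (0,ρ₀'),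
HasGroundStateBEC w ρ). The assembly's hypothesis; follows from CondensateComparison at L =
(N/ρ)^{1/3} (glue ComparisonImpliesTransfer) but may also be proved qualitatively. [difficulty: XL]
(why it might fail: False iff LSSY's open question (Ch. 2 after (2.8)) resolves as "hard- and
soft-core gases of equal a differ w.r.t. BEC"; implied by the conjunct, so no cheap refutation, but
every proof idea in hand runs through the rank-2 corrector bound.) [LSSY2005, LiebYngvason1998,
doi:10.1103/physreva.60.5129,
Literature.Barriers.AtomisticToContinuum.EnergyAsymptoticsWithoutCondensation]
#4 RepresentativeBEC (crux) — X_R — for every real a ≥ 0 there is a bounded admissible v with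
scatteringLength v = ofReal a whose Dirichlet ground state has BEC at all small densities: the
conjunct for ONE representative per scattering length, prover's choice (positive type v̂ ≥ 0 for RP
/ Lee–Yang lines, Born parameter → 0 at fixed a for RG / cluster lines; a = 0 is the free gas).
[difficulty: open-problem] (why it might fail: It is thermodynamic-limit BEC for a genuinely
interacting 3-D gas (open since 1947): the only gain is the free choice of v per a; if no method
closes even the softest representative, the route stalls here with every other.) [LSSY2005,
Fournais2020, FournaisSolovej2020, Benfatto1994, Junge2026,
Literature.Barriers.AtomisticToContinuum.KineticGapLengthScales]
#9 ScatteringLengthFinite (support) — finite range ⇒ scatteringLength v ≠ ⊤ (a ≤ R₀ + ε via the C¹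
trial φ = 0 on B_{R₀}, φ = 1 off B_{R₀+ε}; hard cores included since ⊤ · 0 = 0). Same signature as
BECPinning's stmt-AtomisticToContinuum-0851 (shared item); hypothesis of the Assembly. [difficulty:
provable-now] [LSSY2005]
#9 RepresentativesExist (support) — every real a ≥ 0 is the scattering length of a bounded
admissible profile (top-hat λ·1_{[0,R]} with R = 2a: λ ↦ odeScatteringLength is continuous, 0 at λ =
0, → R(1 − tanh(√(λ/2)R)/(√(λ/2)R)) ↑ R; intermediate value theorem; a = 0 ↦ v = 0) — the existence
half of RepresentativeBEC, over scatteringLength_eq_ofReal_odeScatteringLength. [difficulty: M]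
[LSSY2005]
#9 ComparisonImpliesTransfer (support) — glue — CondensateComparison → ScatteringLengthTransfer: at
L = sideLength ρ N one has N/L³ = ρ (div_sideLength_pow_three), so for ρ < min(ρ₀(v), ρ₁) the
comparison turns ofReal (c N) ≤ condensateNumber v into ofReal (κ c^C N) ≤ condensateNumber w
eventually in N (ENNReal bookkeeping with rpow). [difficulty: provable-now] [LSSY2005]

TWO-LAYER PLAN. Foreseen split of CondensateComparison (k = 3, depth 1) once the definition request
lands: CondensateComparison ⇐
NeutralDressingOscillation → AffinityTransfer → AffinityGlue → CondensateComparison, where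
NeutralDressingOscillation (card T1):
for the positive Dirichlet ground states Ψ_v, Ψ_w and D = Π_{i<j} f_w/f_v (f = scatteringProfile)
the corrector g := Ψ_w/(DΨ_v)
has sup_{x,x'} |log g(x,X̂) − log g(x',X̂)| ≤ K(v,w) for Ψ_w²-typical X̂ (in L^p), uniformly in N at
N/L³ < ρ₁; AffinityTransfer
(card T2, abstract measure theory): an L^p-bounded one-particle oscillation of log dP^w_x/dP^v_x
gives BC(P^w_x,P^w_y) ≥
e^{−cK}·BC(P^v_x,P^v_y)^C; AffinityGlue: γ(x,y) = √(ρ₁(x)ρ₁(y))·BC(P_x,P_y) for a positive ground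
state, Schur bound and Jensen.
ScatteringLengthTransfer ⇐ ComparisonImpliesTransfer (filed as support). RepresentativeBEC ⇐
RepresentativesExist (filed) + BEC
for the chosen family — the latter is another route's crux restricted to the family (PeriodicBEC +
BoundaryTransferWeak of
BECPeriodicReduction, PinnedLowerBound of BECPinning), attached by signature when a method route
commits to a representative.

KILL CRITERIA. Refutation of ScatteringLengthTransfer (an admissible w without small-density BEC
while some bounded equal-a v condenses) closes
the route `refuted:ScatteringLengthTransfer` — and settles LSSY's question negatively, a result in
itself. Refutation of
CondensateComparison alone (κ, C provably N-dependent for some pair) forces a pivot: restate rank 2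
as a qualitative transfer
(compactness / monotone-limit form of X_T), keep the assembly. A proof that
NeutralDressingOscillation needs input of BEC(v)
strength (local mixing ⇔ condensation) demotes the line to its rigidity corollary; then close
`superseded` in favour of the method
route proving BEC + mixing for one representative. RepresentativeBEC refuted means the conjunct
fails for bounded potentials and
kills every route of the sub-problem.

NOT DECOMPOSED YET. The corrector machinery — the positive ground state as an object, Palm /
conditional measures P_x, the h-transformed generator
L, the (≥3)-body remainder Q as a function on configuration space, the cumulant expansion in the
collision density ρR³ — is
layer 2 under CondensateComparison after the definition request lands; the hard-core contact
analysis (w with cores: D vanishes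
in the core, ∇log f_w singular at contact) as a separate child only if provers ask; the choice of
representative family inside
RepresentativeBEC (positive type, small Born parameter, smooth) is deliberately left to whichever
method route attaches; the
d = 1, 2 consistency remarks (the same dressing transfers absence of BEC) stay informal; no negative
statement is filed.

CHEAPEST FALSIFIER. (i) N = 3, 4, 6 bosons in a periodic or Dirichlet cube with two bounded
potentials of equal a (Gaussian core vs top-hat, a matched
through odeScatteringLength): compute Ψ_v, Ψ_w on a grid / by DMC, form g = Ψ_w/(DΨ_v), and check
that H_w(DΨ_v) − E₀^v DΨ_v is
supported on double collisions and that osc_x log g = O(ρR³) without growth in N — a kit job for the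
first refuter (not run
here: planners in plancard mode submit no compute). (ii) Literature check DONE:
Giorgini–Boronat–Casulleras DMC
(doi:10.1103/physreva.60.5129) — hard spheres and soft spheres (R = 5a, 10a) of equal a have equal
energy and condensate
fraction within error bars for na³ ≲ 10⁻³ and separate only beyond; Braaten–Hammer–Hermans
(doi:10.1103/physreva.63.063609) —
the first non-universal correction is of relative order ρa³ (effective range r_s and three-body),
matching the O(ρ²a²R·N) size of
Q. Both consistent with X_T; a documented O(√(ρa³)) discrepancy between equal-a potentials would
have killed the line.
(iii) AffinityTransfer's Hölder loss can be tested on Gaussian toy measures in an afternoon.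

NUMBERS. Energy: e₀(ρ) = 4πρa(1 + (128/15√π)√(ρa³) + o(√(ρa³))) for every admissible v (LSSY2005 Thm
2.1; FournaisSolovej2020,
FournaisSolovej2022 incl. hard cores) — so E₀^w − E₀^v = N·o(ρa√(ρa³)), heuristically N·O(ρ²a²R).
Depletion (Bogoliubov):
1 − n₀/N = (8/3√π)√(ρa³) + O(ρa³ log(ρa³)), universal in a to that order (LSSY2005 App. A);
v-dependence from O(ρa³) on
(doi:10.1103/physreva.63.063609). DMC (doi:10.1103/physreva.60.5129): HS vs SS-5, SS-10
indistinguishable in E/N and n₀/N for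
na³ ≤ 10⁻³. Collision smallness per particle: ρR³·(a/R). Items at open: 7 (3 cruxes, 3 support, 1
assembly).

DEFINITION REQUESTS. - groundState (topic Literature/MathematicalPhysics/QuantumManyBody), filed
after open `--for` the CondensateComparison item: for
  admissible v and N ≥ 1, L > 0 with groundStateEnergy v N L < ⊤, the L²-normalised a.e.-nonnegative
minimiser Ψ₀ of the closed
  Dirichlet form of H_N on Λ_L^N (existence: Rellich compactness; uniqueness and a.e.-positivity on
the accessible chamber:
  positivity-improving semigroup, ReedSimonIV1978 XIII.12 / XIII.47), with the API lemma
condensateNumber v N L = maxOccupation N Ψ₀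
  and its one-particle conditional (Palm) laws P_x; needed to type NeutralDressingOscillation /
AffinityTransfer, and shared with
  cards perron-condensate-wavefunction, palm-hellinger-debye-landscape, wall-dressing-transfer,
kv-insertion-corrector.
- No cite facts requested: no unproved named Literature fact is a hypothesis of any item (the import
cone is definitions only).

Novelty: Searches (2026-08-15): `lit search --hybrid "condensate fraction universality scattering length
different potentials dilute Bose gas"` (12 book hits: LSSY2005, Pethick–Smith, Griffin,
Griffin–Snoke–Stringari — energy universality and Bogoliubov depletion only); `lit search --source
crossref "Bose Einstein condensation depends only on scattering length hard sphere soft potential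
comparison"` (10: Grüter–Ceperley–Laloë 1997 T_c of hard spheres, review chapters; nothing on ODLRO
transfer); `lit search --source crossref "nonuniversal effects in the homogeneous Bose gas"` (→
doi:10.1103/physreva.63.063609); `lit search --source crossref "Ground state of a homogeneous Bose
gas diffusion Monte Carlo"` (→ doi:10.1103/physreva.60.5129); `lit galaxy search "same scattering
length" --star all` (20 rows: Hansen–McDonald, Pathria, Huang, cold-atom EFT arXiv:1001.5071, QMC
theses — none on order-parameter transfer); `lit galaxy search "scattering length universality
Bose-Einstein condensation" --star all` (0 rows); `lit frontier AtomisticToContinuum --since 2022`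
(Junge2026, ChongLiangNam2026: Neumann / kinetic localisation, energy currency); `lit read LSSY2005
--grep "not known at present"` (PDF p. 16: the posed question); plus the card's audit-14 searches
(crossref "equal scattering length dressing ODLRO transfer": nothing; arXiv/OpenAlex rate-limited).
Nearest prior art found: Jastrow 1955 (doi:10.1103/PhysRev.98.1479), Dyson1957 and LSSY2005 (proof
of Thm 2.2, Lemma 2.5 = Dyson lemma):  [refs: 10.1103/physreva.63.063609, 10.1103/physreva.60.5129, 10.1103/PhysRev.98.1479, 10.1103/physreva.60.5129:, 10.1007/BF01210789, 1001.5071, doi:10.1103/physreva.63.063609, doi:10.1103/physreva.60.5129, doi:10.1103/PhysRev.98.1479, doi:10.1007/BF01210789, LSSY2005, Junge2026, ChongLiangNam2026, Dyson1957, BoccatoEtAl2019, Basti2022]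

Barriers (technique_class: universality-transfer ground-state-ratio neutral-corrector): - technique_class: universality-transfer ground-state-ratio neutral-corrector
- Literature.Barriers.AtomisticToContinuum.EnergyAsymptoticsWithoutCondensation: evaded by
construction — no energy asymptotics certify condensation here; E₀^w − E₀^v enters only as the
principal eigenvalue normalising g; X_T is the theorem-shape of the very question this barrier file
quotes (LSSY2005 Ch. 2 after (2.8)).
- Literature.Barriers.AtomisticToContinuum.KineticGapLengthScales: not invoked — no Poincaré / gap
inequality at scale L; the corrector bound is claimed UV-dominated (vertex of Q without 1/k, bounded
static response), which is exactly what NeutralDressingOscillation must deliver; if the cumulant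
expansion secretly needs a gap ~ L⁻², the barrier bites and rank 2 stalls at Fournais scales like
BECPinning.
- Literature.Barriers.AtomisticToContinuum.BogoliubovPerturbationInfrared: the d = 3 marginal
logarithms sit in log Ψ_v and log Ψ_w separately; only their RATIO is expanded, whose soft parts
cancel to leading order at equal a (equal sound speed to relative O(√(ρa³))); the bet is that Q acts
as an s = 2 (derivative-coupled) vertex, IR-finite in d = 3 by the Narrow block — unproved for Q.
- Literature.Barriers.AtomisticToContinuum.OneDimensionalHardCore: consistent rather than evaded —
the transfer is dimension-blind and would carry no-BEC to no-BEC in d = 1; everything d = 3-specific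
is inside RepresentativeBEC.
- Literature.Barriers.AtomisticToContinuum.PitaevskiiStringariOneDimensio

History (route lifecycle, newest last):
- 2026-08-15T13:42:12Z · CLOSED retired — not-a-thesis: assembly does not conclude the sub-problem Statement (operator:999:1257524)

sub-problem: BoseEinsteinCondensation · status: closed(retired) · opened planner-plancard-AtomisticToContinuum-BoseEin-d147e66c-0 2026-08-15T11:31:47Z · rev 0 · ledger route-AtomisticToContinuum-EqualScatteringTransfer
GENERATED by the gate from the ledger (D-0016/17). Provers cite these decls: `theorem foo : Summit.AtomisticToContinuum.BoseEinsteinCondensation.Theses.EqualScatteringTransfer.<Decl> := …` in Summits/AtomisticToContinuum/BoseEinsteinCondensation/Theorems/<Name>.lean.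
-/

namespace Summit.AtomisticToContinuum.BoseEinsteinCondensation.Theses.EqualScatteringTransfer

open scoped BigOperators Topology Manifold Classical MeasureTheory ProbabilityTheory Matrix InnerProductSpace ComplexConjugate ContinuousMap
open Filter Set Function TopologicalSpace MeasureTheory

attribute [summit_statement] _root_.BoseEinsteinCondensation

/-- item stmt-AtomisticToContinuum-4284 · crux · rank 2 · closed · moot by None · by planner
why it might fail: log g, g = Ψ_w/(DΨ_v), is an extensive Feynman–Kac functional; N-uniform one-particle oscillation needs a cumulant expansion in ρR³ resting on local mixing of the Ψ_v² diffusion — possibly as deep as BEC(v); hard-core w adds contact singularities of ∇log f_w; κ, C may drift with N.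
sources: doi:10.1103/PhysRev.98.1479, Dyson1957, LSSY2005, doi:10.1007/BF01210789, doi:10.1103/physreva.63.063609, doi:10.1103/physreva.60.5129
[crux] for admissible v (bounded) and w (arbitrary, hard cores allowed) with scatteringLength v =
scatteringLength w there are ρ₁, κ, C > 0 such that for ALL N ≥ 1 and L > 0 with N/L³ < ρ₁:
condensateNumber w N L ≥ κ · N · (condensateNumber v N L / N)^C — the condensate numbers (λ_max of
the one-particle density matrix of the Dirichlet ground state) of two equal-a gases are comparable
by a power law uniformly in the volume (card T1 + T2 + affinity identity, in typable dress).
[difficulty: XL] -/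
@[route_item "route-AtomisticToContinuum-EqualScatteringTransfer"]
def CondensateComparison : Prop :=
  ∀ v w : ℝ → ENNReal, Literature.MathematicalPhysics.QuantumManyBody.BoseGas.IsRepulsiveFiniteRange v → Literature.MathematicalPhysics.QuantumManyBody.BoseGas.IsRepulsiveFiniteRange w → (∃ M : NNReal, ∀ r, v r ≤ M) → Literature.MathematicalPhysics.QuantumManyBody.BoseGas.scatteringLength v = Literature.MathematicalPhysics.QuantumManyBody.BoseGas.scatteringLength w → ∃ ρ₁ κ C : ℝ, 0 < ρ₁ ∧ 0 < κ ∧ 0 < C ∧ ∀ (N : ℕ) (L : ℝ), 0 < N → 0 < L → (N : ℝ) / L ^ 3 < ρ₁ → ENNReal.ofReal κ * N * (Literature.MathematicalPhysics.QuantumManyBody.BoseGas.condensateNumber v N L / N) ^ C ≤ Literature.MathematicalPhysics.QuantumManyBody.BoseGas.condensateNumber w N L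

/-- item stmt-AtomisticToContinuum-4285 · crux · rank 3 · closed · moot by None · by planner
why it might fail: False iff LSSY's open question (Ch. 2 after (2.8)) resolves as "hard- and soft-core gases of equal a differ w.r.t. BEC"; implied by the conjunct, so no cheap refutation, but every proof idea in hand runs through the rank-2 corrector bound.
sources: LSSY2005, LiebYngvason1998, doi:10.1103/physreva.60.5129, Literature.Barriers.AtomisticToContinuum.EnergyAsymptoticsWithoutCondensation
[crux] X_T — for admissible v, w with v bounded and scatteringLength v = scatteringLength w: (∃ ρ₀ >
0, ∀ ρ ∈ (0,ρ₀), HasGroundStateBEC v ρ) → (∃ ρ₀' > 0, ∀ ρ ∈ (0,ρ₀'), HasGroundStateBEC w ρ). The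
assembly's hypothesis; follows from CondensateComparison at L = (N/ρ)^{1/3} (glue
ComparisonImpliesTransfer) but may also be proved qualitatively. [difficulty: XL] -/
@[route_item "route-AtomisticToContinuum-EqualScatteringTransfer"]
def ScatteringLengthTransfer : Prop :=
  ∀ v w : ℝ → ENNReal, Literature.MathematicalPhysics.QuantumManyBody.BoseGas.IsRepulsiveFiniteRange v → Literature.MathematicalPhysics.QuantumManyBody.BoseGas.IsRepulsiveFiniteRange w → (∃ M : NNReal, ∀ r, v r ≤ M) → Literature.MathematicalPhysics.QuantumManyBody.BoseGas.scatteringLength v = Literature.MathematicalPhysics.QuantumManyBody.BoseGas.scatteringLength w → (∃ ρ₀ : ℝ, 0 < ρ₀ ∧ ∀ ρ : ℝ, 0 < ρ → ρ < ρ₀ → Literature.MathematicalPhysics.QuantumManyBody.BoseGas.HasGroundStateBEC v ρ) → ∃ ρ₀ : ℝ, 0 < ρ₀ ∧ ∀ ρ : ℝ, 0 < ρ → ρ < ρ₀ → Literature.MathematicalPhysics.QuantumManyBody.BoseGas.HasGroundStateBEC w ρ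

/-- item stmt-AtomisticToContinuum-4286 · crux · rank 4 · closed · moot by None · by planner
why it might fail: It is thermodynamic-limit BEC for a genuinely interacting 3-D gas (open since 1947): the only gain is the free choice of v per a; if no method closes even the softest representative, the route stalls here with every other.
sources: LSSY2005, Fournais2020, FournaisSolovej2020, Benfatto1994, Junge2026, Literature.Barriers.AtomisticToContinuum.KineticGapLengthScales
[crux] X_R — for every real a ≥ 0 there is a bounded admissible v with scatteringLength v = ofReal a
whose Dirichlet ground state has BEC at all small densities: the conjunct for ONE representative per
scattering length, prover's choice (positive type v̂ ≥ 0 for RP / Lee–Yang lines, Born parameter → 0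
at fixed a for RG / cluster lines; a = 0 is the free gas). [difficulty: open-problem] -/
@[route_item "route-AtomisticToContinuum-EqualScatteringTransfer"]
def RepresentativeBEC : Prop :=
  ∀ a : ℝ, 0 ≤ a → ∃ v : ℝ → ENNReal, Literature.MathematicalPhysics.QuantumManyBody.BoseGas.IsRepulsiveFiniteRange v ∧ (∃ M : NNReal, ∀ r, v r ≤ M) ∧ Literature.MathematicalPhysics.QuantumManyBody.BoseGas.scatteringLength v = ENNReal.ofReal a ∧ ∃ ρ₀ : ℝ, 0 < ρ₀ ∧ ∀ ρ : ℝ, 0 < ρ → ρ < ρ₀ → Literature.MathematicalPhysics.QuantumManyBody.BoseGas.HasGroundStateBEC v ρ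

/-- item stmt-AtomisticToContinuum-0851 · support · rank 9 · closed · moot by None · by planner
sources: LSSY2005
[support] ScatteringLengthFinite: finite range R₀ ⇒ scatteringLength v ≠ ⊤ (indeed a ≤ R₀+ε: trial φ
∈ C¹, φ = 0 on B_{R₀}, φ = 1 off B_{R₀+ε}, so v·φ² = 0 incl. hard cores since ⊤·0 = 0).
[LiebSeiringerSolovejYngvason2005 App. C, Thm C.1 and Remark; scatteringLength_le] -/
@[route_item "route-AtomisticToContinuum-EqualScatteringTransfer"]
def ScatteringLengthFinite : Prop :=
  ∀ v : ℝ → ENNReal, Literature.MathematicalPhysics.QuantumManyBody.BoseGas.IsRepulsiveFiniteRange v → Literature.MathematicalPhysics.QuantumManyBody.BoseGas.scatteringLength v ≠ ⊤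

/-- item stmt-AtomisticToContinuum-4287 · support · rank 9 · closed · moot by None · by planner
sources: LSSY2005
[support] every real a ≥ 0 is the scattering length of a bounded admissible profile (top-hat
λ·1_{[0,R]} with R = 2a: λ ↦ odeScatteringLength is continuous, 0 at λ = 0, → R(1 −
tanh(√(λ/2)R)/(√(λ/2)R)) ↑ R; intermediate value theorem; a = 0 ↦ v = 0) — the existence half of
RepresentativeBEC, over scatteringLength_eq_ofReal_odeScatteringLength. [difficulty: M] -/
@[route_item "route-AtomisticToContinuum-EqualScatteringTransfer"]
def RepresentativesExist : Prop :=
  ∀ a : ℝ, 0 ≤ a → ∃ v : ℝ → ENNReal, Literature.MathematicalPhysics.QuantumManyBody.BoseGas.IsRepulsiveFiniteRange v ∧ (∃ M : NNReal, ∀ r, v r ≤ M) ∧ Literature.MathematicalPhysics.QuantumManyBody.BoseGas.scatteringLength v = ENNReal.ofReal a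

/-- item stmt-AtomisticToContinuum-4288 · support · rank 9 · closed · moot by None · by planner
sources: LSSY2005
[support] glue — CondensateComparison → ScatteringLengthTransfer: at L = sideLength ρ N one has N/L³
= ρ (div_sideLength_pow_three), so for ρ < min(ρ₀(v), ρ₁) the comparison turns ofReal (c N) ≤
condensateNumber v into ofReal (κ c^C N) ≤ condensateNumber w eventually in N (ENNReal bookkeeping
with rpow). [difficulty: provable-now] -/
@[route_item "route-AtomisticToContinuum-EqualScatteringTransfer"]
def ComparisonImpliesTransfer : Prop :=
  CondensateComparison → ScatteringLengthTransfer

/-- item stmt-AtomisticToContinuum-4289 · assembly · rank 1 · closed · moot by None · by planner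
sources: LSSY2005
[assembly] ScatteringLengthTransfer → RepresentativeBEC → ScatteringLengthFinite →
BoseEinsteinCondensation. -/
@[route_item "route-AtomisticToContinuum-EqualScatteringTransfer"]
def Assembly : Prop :=
  ScatteringLengthTransfer → RepresentativeBEC → ScatteringLengthFinite → Literature.MathematicalPhysics.QuantumManyBody.BoseGas.BoseEinsteinCondensation

end Summit.AtomisticToContinuum.BoseEinsteinCondensation.Theses.EqualScatteringTransfer
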